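import Literature.NumberTheory.GaloisRepresentations.PowerSeriesTopNilpotentModule
import Literature.NumberTheory.GaloisRepresentations.LubinTateColemanCoordDeltaTwoVariable
import HarnessLib

/-!
# The Coleman coordinate module at `q = 2` as an honest `Λ`-MODULE: `S⟦Y⟧` over `Λ = S⟦T⟧` (`T ↦ D_γ = σ_γ − 1`), the unit twists
# `σ_v` as `Λ`-linear automorphisms, and the two `Λ`-bases `{1, Y}` and `{1, σ_{−1}(1)}` (free of rank two; rank one over `Λ[Δ]`)

De Shalit, *Iwasawa theory of elliptic curves with complex multiplication* (1987), Ch. I §3.1 ("`ℤ_p⟦𝒢⟧ = Λ[Δ]`"), §3.4 Lemma (ii), §3.7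
Theorem, §3.8 (17); Ch. III §1.3: the (semi-)local units of the Lubin–Tate tower form, through Coleman's power series, a module over
the Iwasawa algebra of `𝒢 = Gal(k^{ur}K_π^∞/k)`.  In the tree's series currency at `q = 2` (`π = 2u`, `f = πX + X²`) the coordinate
module is `S⟦Y⟧` (`S = 𝒪_F` for one prime and one unramified level, `S = 𝒪_F⟦X⟧` for the two-variable tower, any `𝒪_F`-algebra
`ι : 𝒪_F → S` in general), the Lubin–Tate direction acts by the twists `𝐋_v r = v·ρ_v·(r ∘ [v]_f)` (`twistLinearBase ι u v = 𝐋_v − 1`),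
and `LubinTateColemanCoordFreeTwoVariable` / `LubinTateColemanCoordDeltaTwoVariable` proved the two unique-representation theorems
`S⟦Y⟧ = S⟦T⟧·1 ⊕ S⟦T⟧·Y = S⟦T⟧·1 ⊕ S⟦T⟧·σ_{−1}(1)` for `T` acting as `D_γ`, `γ = 1 + π²w`.  THIS file packages all of it as
MATHLIB MODULE THEORY (via `PowerSeriesTopNilpotentModule`):

* §1 the twists over any base `ι` compose like the group: ★ `twistLinearBase_comp_add` (`𝐋_v 𝐋_{v'} = 𝐋_{vv'}`, from the one-variable
  cocycle `unitTwist_comp` by base change), `twistLinearBase_comm`, `twistLinearBase_one_add_self` (`𝐋_1 = id`);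
* §2 **`ColemanCoordModule hπ hq ι u hu γ`** `:= TActModule (D_γ^S) _` — `S⟦Y⟧` as a `Module (PowerSeries S)`, `T • r = D_γ r`;
  ★ **`unitTwistₗ v`** — `σ_v = 1 + D_v` as an `S⟦T⟧`-LINEAR endomorphism (`TActModule.linearOfCommute`), with `unitTwistₗ_mul`
  (`σ_{vv'} = σ_v ∘ σ_{v'}`), `unitTwistₗ_one`, `unitTwistₗ_comm`, ★ `unitTwistₗ_self : σ_γ r = (1 + T) • r`,
  `unitTwistₗ_pow : σ_{γ^n} r = (1 + T)^n • r` — the `𝒪_F^×`-action IS the `Λ`-module structure on the generator `γ` and commutes with it;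
* §3 ★★ **`coordBasis`** — the `Module.Basis (Fin 2) (PowerSeries S)` `{1, Y}` (so `Module.Free`, `Module.Finite`, `finrank = 2`:
  `finrank_colemanCoordModule`), and ★★ **`coordBasisDelta`** — the `Module.Basis (Fin 2)` `{1, σ_{−1}(1)}`: **the coordinate module is
  `Λ·1 ⊕ Λ·σ_{−1}(1)`, i.e. free of rank ONE over `Λ[Δ]`, `Δ = {±1}`, generated by `1`** (de Shalit's `𝒰 ≅ Λ(𝒢)` at `p = 2`, series side);
* §4 the two-variable instance `S = 𝒪_F⟦X⟧`, `ι = C` (`Λ = 𝒪_F⟦X⟧⟦T⟧`, the shape of the tree's `IwasawaAlgebra₂`: OUTER variable the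
  Lubin–Tate direction, INNER variable the unramified direction): `finrank_colemanCoordModule_C = 2`, and the unramified variable acts
  through the coefficients (`C_smul`: `(C s) • G = s·G`, in particular `φ ↦ ·(1+X)`).

Everything PROVED (0 sorry, no named facts).  Definitions: `ColemanCoordModule` (abbrev of `TActModule`), `unitTwistₗ`, `coordBasis`,
`coordBasisDelta`.  NOT here: the norm-coherent units themselves and the image of the Coleman transform as a submodule (sequel
`LubinTateColemanUnitsImageModuleTwo`), the `ℤ/d`-indexed product for towers with an odd part (it is the `Pi`-module of `d` copies).

## References

* E. de Shalit, *Iwasawa theory of elliptic curves with complex multiplication* (1987), Ch. I §3.1, §3.4 Lemma (ii), §3.7, §3.8 (17);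
  Ch. III §1.3. [deShalit1987]
* L. C. Washington, *Introduction to Cyclotomic Fields*, 2nd ed. (1997), §13.2. [Washington1997]
-/

noncomputable section

namespace Literature.NumberTheory.GaloisRepresentations

section CoordModuleTwo

open GaloisRepresentations.IsNonarchimedeanLocalField LubinTate ValuativeRel Finset

variable {F : Type} [Field F] [ValuativeRel F] [TopologicalSpace F] [IsNonarchimedeanLocalField F]

attribute [local instance] ltNormUniformSpace ltNormIsUniformAddGroup rk1 nF nE fintypeResidueField

variable {π : 𝒪[F]} (hπ : (valuation F).IsUniformizer (π : F)) (hq : residueFieldCard F = 2)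
variable {S : Type*} [CommRing S] (ι : LTCoeff F →+* S)

/-! ### §1. The twists `𝐋_v = D_v + 1` over a base `ι : 𝒪_F → S` compose like the group `𝒪_F^×` -/

/-- `[v]_f` pushed along `ι` is substitutable. [folklore] -/
private theorem hasSubst_map_hom (v : LTCoeff F) :
    PowerSeries.HasSubst (PowerSeries.map ι (hom (isLTRing_LTCoeff hπ) (isLTSeries_LTCoeff π) (isLTSeries_LTCoeff π) v)) :=
  PowerSeries.HasSubst.of_constantCoeff_zero' (by
    rw [← PowerSeries.coeff_zero_eq_constantCoeff, PowerSeries.coeff_map, PowerSeries.coeff_zero_eq_constantCoeff, constantCoeff_hom,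
      map_zero])

/-- `[v]_f` is substitutable. [folklore] -/
private theorem hasSubst_hom₁ (v : LTCoeff F) :
    PowerSeries.HasSubst (hom (isLTRing_LTCoeff hπ) (isLTSeries_LTCoeff π) (isLTSeries_LTCoeff π) v) :=
  PowerSeries.HasSubst.of_constantCoeff_zero' (constantCoeff_hom _ _ _ v)

/-- **`𝐋_v r = D_v r + r = ι(v ρ_v)·(r ∘ ι[v]_f)`** on `S⟦Y⟧`. [cite: deShalit1987, Ch. I §3.4 Lemma (ii)] -/
theorem twistLinearBase_add_self (u : (LTCoeff F)ˣ) (v : 𝒪[F]ˣ) (r : PowerSeries S) :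
    twistLinearBase hπ hq ι u v r + r =
      PowerSeries.map ι (PowerSeries.C (LTCoeff.of F (v : 𝒪[F])) * evenPartTwo hπ hq (unitTwistSerTwo hπ (↑u⁻¹ : LTCoeff F) v)) *
        PowerSeries.subst (PowerSeries.map ι
          (hom (isLTRing_LTCoeff hπ) (isLTSeries_LTCoeff π) (isLTSeries_LTCoeff π) (LTCoeff.of F (v : 𝒪[F])))) r := by
  rw [twistLinearBase_apply, sub_add_cancel, map_mul, PowerSeries.map_C]

/-- `subst φ 1 = 1`. [folklore] -/
private theorem subst_one_eq {R : Type*} [CommRing R] {φ : PowerSeries R} (hφ : PowerSeries.HasSubst φ) :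
    PowerSeries.subst φ (1 : PowerSeries R) = 1 := by
  rw [← PowerSeries.coe_substAlgHom hφ, map_one]

/-- The one-variable identity `v ρ_v · ((v' ρ_{v'}) ∘ [v]) = (vv') ρ_{vv'}` (`unitTwist_comp` at `r = 1`). [cite: deShalit1987, Ch. I §3.4 Lemma (ii)] -/
theorem unitTwist_coeff_mul (u : (LTCoeff F)ˣ) (hu : LTCoeff.of F π = residueFieldCard F * u) (v v' : 𝒪[F]ˣ) :
    PowerSeries.C (LTCoeff.of F (v : 𝒪[F])) * evenPartTwo hπ hq (unitTwistSerTwo hπ (↑u⁻¹ : LTCoeff F) v) *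
        PowerSeries.subst (hom (isLTRing_LTCoeff hπ) (isLTSeries_LTCoeff π) (isLTSeries_LTCoeff π) (LTCoeff.of F (v : 𝒪[F])))
          (PowerSeries.C (LTCoeff.of F (v' : 𝒪[F])) * evenPartTwo hπ hq (unitTwistSerTwo hπ (↑u⁻¹ : LTCoeff F) v')) =
      PowerSeries.C (LTCoeff.of F ((v * v' : 𝒪[F]ˣ) : 𝒪[F])) * evenPartTwo hπ hq (unitTwistSerTwo hπ (↑u⁻¹ : LTCoeff F) (v * v')) := by
  have h := unitTwist_comp hπ hq u hu v v' 1
  rwa [subst_one_eq (hasSubst_hom₁ hπ (LTCoeff.of F (v' : 𝒪[F]))), mul_one,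
    subst_one_eq (hasSubst_hom₁ hπ (LTCoeff.of F ((v * v' : 𝒪[F]ˣ) : 𝒪[F]))), mul_one] at h

/-- ★ **The cocycle over any base: `𝐋_v(𝐋_{v'} r) = 𝐋_{vv'} r` on `S⟦Y⟧`** (base change of `unitTwist_comp` along `ι`, valid for EVERY
`r ∈ S⟦Y⟧`, not only for series coming from `𝒪_F⟦Y⟧`). [cite: deShalit1987, Ch. I §3.4 Lemma (ii), §3.7] -/
theorem twistLinearBase_comp_add (u : (LTCoeff F)ˣ) (hu : LTCoeff.of F π = residueFieldCard F * u) (v v' : 𝒪[F]ˣ) (r : PowerSeries S) :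
    twistLinearBase hπ hq ι u v (twistLinearBase hπ hq ι u v' r + r) + (twistLinearBase hπ hq ι u v' r + r) =
      twistLinearBase hπ hq ι u (v * v') r + r := by
  have hsv := hasSubst_map_hom hπ ι (LTCoeff.of F (v : 𝒪[F]))
  have hsv' := hasSubst_map_hom hπ ι (LTCoeff.of F (v' : 𝒪[F]))
  have hs₁ := hasSubst_hom₁ hπ (LTCoeff.of F (v : 𝒪[F]))
  -- the two one-variable identities, base-changed along `ι`
  have key1 : PowerSeries.map ι (PowerSeries.C (LTCoeff.of F (v : 𝒪[F])) * evenPartTwo hπ hq (unitTwistSerTwo hπ (↑u⁻¹ : LTCoeff F) v)) *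
      PowerSeries.subst (PowerSeries.map ι
          (hom (isLTRing_LTCoeff hπ) (isLTSeries_LTCoeff π) (isLTSeries_LTCoeff π) (LTCoeff.of F (v : 𝒪[F]))))
        (PowerSeries.map ι (PowerSeries.C (LTCoeff.of F (v' : 𝒪[F])) * evenPartTwo hπ hq (unitTwistSerTwo hπ (↑u⁻¹ : LTCoeff F) v'))) =
      PowerSeries.map ι (PowerSeries.C (LTCoeff.of F ((v * v' : 𝒪[F]ˣ) : 𝒪[F])) *
        evenPartTwo hπ hq (unitTwistSerTwo hπ (↑u⁻¹ : LTCoeff F) (v * v'))) := by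
    have e : PowerSeries.map ι (PowerSeries.subst
        (hom (isLTRing_LTCoeff hπ) (isLTSeries_LTCoeff π) (isLTSeries_LTCoeff π) (LTCoeff.of F (v : 𝒪[F])))
        (PowerSeries.C (LTCoeff.of F (v' : 𝒪[F])) * evenPartTwo hπ hq (unitTwistSerTwo hπ (↑u⁻¹ : LTCoeff F) v'))) =
        PowerSeries.subst (PowerSeries.map ι
          (hom (isLTRing_LTCoeff hπ) (isLTSeries_LTCoeff π) (isLTSeries_LTCoeff π) (LTCoeff.of F (v : 𝒪[F]))))
          (PowerSeries.map ι (PowerSeries.C (LTCoeff.of F (v' : 𝒪[F])) * evenPartTwo hπ hq (unitTwistSerTwo hπ (↑u⁻¹ : LTCoeff F) v'))) :=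
      PowerSeries.map_subst hs₁ _
    rw [← e, ← map_mul, unitTwist_coeff_mul hπ hq u hu v v']
  have key2 : PowerSeries.subst (PowerSeries.map ι
        (hom (isLTRing_LTCoeff hπ) (isLTSeries_LTCoeff π) (isLTSeries_LTCoeff π) (LTCoeff.of F (v : 𝒪[F]))))
      (PowerSeries.map ι (hom (isLTRing_LTCoeff hπ) (isLTSeries_LTCoeff π) (isLTSeries_LTCoeff π) (LTCoeff.of F (v' : 𝒪[F])))) =
      PowerSeries.map ι (hom (isLTRing_LTCoeff hπ) (isLTSeries_LTCoeff π) (isLTSeries_LTCoeff π) (LTCoeff.of F ((v * v' : 𝒪[F]ˣ) : 𝒪[F]))) := by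
    have e : PowerSeries.map ι (PowerSeries.subst
        (hom (isLTRing_LTCoeff hπ) (isLTSeries_LTCoeff π) (isLTSeries_LTCoeff π) (LTCoeff.of F (v : 𝒪[F])))
        (hom (isLTRing_LTCoeff hπ) (isLTSeries_LTCoeff π) (isLTSeries_LTCoeff π) (LTCoeff.of F (v' : 𝒪[F])))) =
        PowerSeries.subst (PowerSeries.map ι
          (hom (isLTRing_LTCoeff hπ) (isLTSeries_LTCoeff π) (isLTSeries_LTCoeff π) (LTCoeff.of F (v : 𝒪[F]))))
          (PowerSeries.map ι (hom (isLTRing_LTCoeff hπ) (isLTSeries_LTCoeff π) (isLTSeries_LTCoeff π) (LTCoeff.of F (v' : 𝒪[F])))) :=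
      PowerSeries.map_subst hs₁ _
    rw [← e, subst_hom_hom hπ, Units.val_mul, map_mul, mul_comm]
  rw [twistLinearBase_add_self, twistLinearBase_add_self, twistLinearBase_add_self, PowerSeries.subst_mul hsv,
    PowerSeries.subst_comp_subst_apply hsv' hsv, key2, ← mul_assoc, key1]

/-- ★ **The twists commute over any base: `D_v(D_{v'} r) = D_{v'}(D_v r)`** (`𝒪_F^×` is abelian). [cite: deShalit1987, Ch. I §3.4 Lemma (ii), §3.7] -/
theorem twistLinearBase_comm (u : (LTCoeff F)ˣ) (hu : LTCoeff.of F π = residueFieldCard F * u) (v v' : 𝒪[F]ˣ) (r : PowerSeries S) :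
    twistLinearBase hπ hq ι u v (twistLinearBase hπ hq ι u v' r) = twistLinearBase hπ hq ι u v' (twistLinearBase hπ hq ι u v r) := by
  have h1 := twistLinearBase_comp_add hπ hq ι u hu v v' r
  have h2 := twistLinearBase_comp_add hπ hq ι u hu v' v r
  rw [mul_comm v' v] at h2
  rw [map_add] at h1 h2
  linear_combination h1 - h2

/-- **`𝐋_1 = id`: `D_1 r + r = r`** over any base (`ρ_1 = 1`, `[1]_f = X`). [cite: deShalit1987, Ch. I §3.4 Lemma (ii)] -/
theorem twistLinearBase_one_add_self (u : (LTCoeff F)ˣ) (hu : LTCoeff.of F π = residueFieldCard F * u) (r : PowerSeries S) :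
    twistLinearBase hπ hq ι u 1 r + r = r := by
  rw [twistLinearBase_add_self]
  have hX : hom (isLTRing_LTCoeff hπ) (isLTSeries_LTCoeff π) (isLTSeries_LTCoeff π) (LTCoeff.of F ((1 : 𝒪[F]ˣ) : 𝒪[F])) = PowerSeries.X := by
    rw [Units.val_one, map_one]; exact hom_one _ _
  have hρ : PowerSeries.C (LTCoeff.of F ((1 : 𝒪[F]ˣ) : 𝒪[F])) * evenPartTwo hπ hq (unitTwistSerTwo hπ (↑u⁻¹ : LTCoeff F) 1) = 1 := by
    have h := unitTwist_one hπ hq u hu 1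
    rwa [subst_one_eq (hasSubst_hom₁ hπ _), mul_one] at h
  have hid : PowerSeries.subst (PowerSeries.X : PowerSeries S) r = r := by
    rw [← PowerSeries.map_algebraMap_eq_subst_X, Algebra.algebraMap_self, PowerSeries.map_id, id]
  rw [hρ, map_one, one_mul, hX, PowerSeries.map_X, hid]

/-! ### §2. The module and the unit twists as `Λ`-linear maps -/

variable [IsAdicComplete (Ideal.span {ι (LTCoeff.of F π)}) S]

/-- **`ColemanCoordModule hπ hq ι u hu γ`**: the Coleman coordinate module `S⟦Y⟧` at `q = 2` as a module over `Λ = S⟦T⟧`, `T` acting as the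
twist `D_γ = σ_γ − 1` (`TActModule` of `twistLinearBase ι u γ`). [cite: deShalit1987, Ch. I §3.1, §3.7] -/
abbrev ColemanCoordModule (u : (LTCoeff F)ˣ) (hu : LTCoeff.of F π = residueFieldCard F * u) (γ : 𝒪[F]ˣ) : Type _ :=
  TActModule (twistLinearBase hπ hq ι u γ) (twistLinearBase_mem_adicFiltGen_succ hπ hq ι u hu γ)

variable (u : (LTCoeff F)ˣ) (hu : LTCoeff.of F π = residueFieldCard F * u) (γ : 𝒪[F]ˣ)

/-- ★ **`σ_v = 1 + D_v` as an `S⟦T⟧`-LINEAR endomorphism of the coordinate module** (it commutes with `D_γ` and preserves the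
`(ιπ, Y)`-adic filtration). [cite: deShalit1987, Ch. I §3.4 Lemma (ii), §3.7] -/
def unitTwistₗ (v : 𝒪[F]ˣ) : ColemanCoordModule hπ hq ι u hu γ →ₗ[PowerSeries S] ColemanCoordModule hπ hq ι u hu γ :=
  LinearMap.id + TActModule.linearOfCommute _ _ (twistLinearBase hπ hq ι u v)
    (fun r => twistLinearBase_comm hπ hq ι u hu v γ r)
    (fun N r hr => adicFiltGen_mono (Nat.le_succ N) (twistLinearBase_mem_adicFiltGen_succ hπ hq ι u hu v N r hr))

/-- Unfolding: `toPS (σ_v r) = D_v (toPS r) + toPS r`. [cite: deShalit1987, Ch. I §3.4 Lemma (ii)] -/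
theorem toPS_unitTwistₗ (v : 𝒪[F]ˣ) (r : ColemanCoordModule hπ hq ι u hu γ) :
    TActModule.toPS (unitTwistₗ hπ hq ι u hu γ v r) = twistLinearBase hπ hq ι u v (TActModule.toPS r) + TActModule.toPS r := by
  rw [unitTwistₗ, LinearMap.add_apply, LinearMap.id_apply, map_add, TActModule.toPS_linearOfCommute_apply, add_comm]

/-- `σ_v (ofPS r) = ofPS (D_v r + r)`. [cite: deShalit1987, Ch. I §3.4 Lemma (ii)] -/
theorem unitTwistₗ_ofPS (v : 𝒪[F]ˣ) (r : PowerSeries S) :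
    unitTwistₗ hπ hq ι u hu γ v (TActModule.ofPS _ _ r) = TActModule.ofPS _ _ (twistLinearBase hπ hq ι u v r + r) :=
  TActModule.toPS_injective (toPS_unitTwistₗ hπ hq ι u hu γ v _)

/-- ★ **`σ_{vv'} = σ_v ∘ σ_{v'}`** on the coordinate module. [cite: deShalit1987, Ch. I §3.4 Lemma (ii), §3.7] -/
theorem unitTwistₗ_mul (v v' : 𝒪[F]ˣ) :
    unitTwistₗ hπ hq ι u hu γ (v * v') = unitTwistₗ hπ hq ι u hu γ v ∘ₗ unitTwistₗ hπ hq ι u hu γ v' := by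
  refine LinearMap.ext fun r => TActModule.toPS_injective ?_
  rw [LinearMap.comp_apply, toPS_unitTwistₗ, toPS_unitTwistₗ, toPS_unitTwistₗ, twistLinearBase_comp_add hπ hq ι u hu]

/-- `σ_v ∘ σ_{v'} = σ_{v'} ∘ σ_v`. [cite: deShalit1987, Ch. I §3.7] -/
theorem unitTwistₗ_comm (v v' : 𝒪[F]ˣ) :
    unitTwistₗ hπ hq ι u hu γ v ∘ₗ unitTwistₗ hπ hq ι u hu γ v' = unitTwistₗ hπ hq ι u hu γ v' ∘ₗ unitTwistₗ hπ hq ι u hu γ v := by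
  rw [← unitTwistₗ_mul, ← unitTwistₗ_mul, mul_comm]

/-- `σ_1 = id`. [cite: deShalit1987, Ch. I §3.4 Lemma (ii)] -/
theorem unitTwistₗ_one : unitTwistₗ hπ hq ι u hu γ 1 = LinearMap.id := by
  refine LinearMap.ext fun r => TActModule.toPS_injective ?_
  rw [toPS_unitTwistₗ, twistLinearBase_one_add_self hπ hq ι u hu, LinearMap.id_apply]

/-- ★ **`σ_γ r = (1 + T) • r`**: on the distinguished unit `γ` the Galois action IS the module structure. [cite: deShalit1987, Ch. I §3.1] -/
theorem unitTwistₗ_self (r : ColemanCoordModule hπ hq ι u hu γ) :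
    unitTwistₗ hπ hq ι u hu γ γ r = (1 + PowerSeries.X : PowerSeries S) • r := by
  apply TActModule.toPS_injective
  rw [toPS_unitTwistₗ, add_smul, one_smul, map_add, TActModule.X_smul, TActModule.toPS_ofPS, add_comm]

/-- ★ **`σ_{γ^n} r = (1 + T)^n • r`**. [cite: deShalit1987, Ch. I §3.1] -/
theorem unitTwistₗ_pow (n : ℕ) (r : ColemanCoordModule hπ hq ι u hu γ) :
    unitTwistₗ hπ hq ι u hu γ (γ ^ n) r = ((1 + PowerSeries.X) ^ n : PowerSeries S) • r := by
  induction n generalizing r with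
  | zero => rw [pow_zero, unitTwistₗ_one, pow_zero, one_smul, LinearMap.id_apply]
  | succ n ih => rw [pow_succ, unitTwistₗ_mul, LinearMap.comp_apply, unitTwistₗ_self, ih, ← mul_smul, ← pow_succ]

/-- `σ_v` commutes with the scalars (it is `Λ`-linear — restated as an identity for rewriting). [cite: deShalit1987, Ch. I §3.7] -/
theorem unitTwistₗ_smul (v : 𝒪[F]ˣ) (c : PowerSeries S) (r : ColemanCoordModule hπ hq ι u hu γ) :
    unitTwistₗ hπ hq ι u hu γ v (c • r) = c • unitTwistₗ hπ hq ι u hu γ v r :=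
  map_smul _ c r

/-! ### §3. The two bases: `{1, Y}` and `{1, σ_{−1}(1)}` -/

variable (hreg : ∀ x : S, ι (LTCoeff.of F π) * x = 0 → x = 0) (w : 𝒪[F]ˣ) (hγ : (γ : 𝒪[F]) = 1 + π ^ 2 * w)

/-- ★★ **The `Λ`-basis `{1, Y}` of the coordinate module** (`γ = 1 + π²w`, `S` `(ιπ)`-complete, `ιπ` regular).
[cite: deShalit1987, Ch. I §3.1, §3.7, §3.8 (17)] -/
def coordBasis : Module.Basis (Fin 2) (PowerSeries S) (ColemanCoordModule hπ hq ι u hu γ) :=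
  TActModule.basis _ _ 2 (twistLinearBase_X_pow_sub_mem_degFilt hπ hq ι u hu γ w hγ) two_pos hreg

/-- The basis vectors are `Y^j`: `toPS (coordBasis j) = Y^j`. [cite: deShalit1987, Ch. I §3.1] -/
@[simp] theorem toPS_coordBasis (j : Fin 2) :
    TActModule.toPS (coordBasis hπ hq ι u hu γ hreg w hγ j) = PowerSeries.X ^ (j : ℕ) := by
  rw [coordBasis, TActModule.basis_apply, TActModule.toPS_basisFun]

/-- `coordBasis 0 = 1`. [cite: deShalit1987, Ch. I §3.1] -/
theorem coordBasis_zero : coordBasis hπ hq ι u hu γ hreg w hγ 0 = TActModule.ofPS _ _ 1 :=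
  TActModule.toPS_injective (by rw [toPS_coordBasis, Fin.val_zero, pow_zero, TActModule.toPS_ofPS])

/-- `coordBasis 1 = Y`. [cite: deShalit1987, Ch. I §3.1] -/
theorem coordBasis_one : coordBasis hπ hq ι u hu γ hreg w hγ 1 = TActModule.ofPS _ _ PowerSeries.X :=
  TActModule.toPS_injective (by rw [toPS_coordBasis, Fin.val_one, pow_one, TActModule.toPS_ofPS])

include hreg hγ in
/-- The coordinate module is a free `Λ`-module. [cite: deShalit1987, Ch. I §3.7] -/
theorem free_colemanCoordModule : Module.Free (PowerSeries S) (ColemanCoordModule hπ hq ι u hu γ) :=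
  Module.Free.of_basis (coordBasis hπ hq ι u hu γ hreg w hγ)

include hreg hγ in
/-- The coordinate module is a finitely generated `Λ`-module. [cite: deShalit1987, Ch. I §3.7] -/
theorem finite_colemanCoordModule : Module.Finite (PowerSeries S) (ColemanCoordModule hπ hq ι u hu γ) :=
  Module.Finite.of_basis (coordBasis hπ hq ι u hu γ hreg w hγ)

include hreg hγ in
/-- ★★ **`rank_Λ (coordinate module) = 2`**, `Λ = S⟦T⟧`. [cite: deShalit1987, Ch. I §3.7, §3.8 (17)] -/
theorem finrank_colemanCoordModule [Nontrivial S] : Module.finrank (PowerSeries S) (ColemanCoordModule hπ hq ι u hu γ) = 2 :=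
  TActModule.finrank_eq (twistLinearBase_X_pow_sub_mem_degFilt hπ hq ι u hu γ w hγ) two_pos hreg

/-- The candidate `Δ`-basis: `1` and `σ_{−1}(1)`. [cite: deShalit1987, Ch. I §3.1] -/
def deltaFun : Fin 2 → ColemanCoordModule hπ hq ι u hu γ :=
  ![TActModule.ofPS _ _ 1, unitTwistₗ hπ hq ι u hu γ (-1) (TActModule.ofPS _ _ 1)]

/-- `toPS (σ_{−1}(1)) = −map ι ρ_{−1}`. [cite: deShalit1987, Ch. I §3.4 Lemma (ii)] -/
theorem toPS_unitTwistₗ_neg_one_one :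
    TActModule.toPS (unitTwistₗ hπ hq ι u hu γ (-1) (TActModule.ofPS _ _ 1)) =
      -PowerSeries.map ι (evenPartTwo hπ hq (unitTwistSerTwo hπ (↑u⁻¹ : LTCoeff F) (-1))) := by
  rw [toPS_unitTwistₗ, TActModule.toPS_ofPS, twistLinearBase_neg_one_one_add]

/-- A linear combination of the `Δ`-candidates is `a·1 + b·σ_{−1}(1)` in the `tAct` currency. [cite: deShalit1987, Ch. I §3.1] -/
theorem toPS_sum_smul_deltaFun (g : Fin 2 → PowerSeries S) :
    TActModule.toPS (∑ j : Fin 2, g j • deltaFun hπ hq ι u hu γ j) =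
      tAct (twistLinearBase hπ hq ι u γ) (twistLinearBase_mem_adicFiltGen_succ hπ hq ι u hu γ) (g 0) 1 +
        tAct (twistLinearBase hπ hq ι u γ) (twistLinearBase_mem_adicFiltGen_succ hπ hq ι u hu γ) (g 1)
          (-PowerSeries.map ι (evenPartTwo hπ hq (unitTwistSerTwo hπ (↑u⁻¹ : LTCoeff F) (-1)))) := by
  rw [Fin.sum_univ_two, map_add, TActModule.toPS_smul, TActModule.toPS_smul, deltaFun, Matrix.cons_val_zero, Matrix.cons_val_one,
    Matrix.cons_val_zero, TActModule.toPS_ofPS, toPS_unitTwistₗ_neg_one_one]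

include hreg hγ in
/-- ★ `1, σ_{−1}(1)` are linearly independent over `Λ` (uniqueness half of `existsUnique_tAct_one_add_tAct_delta_base`).
[cite: deShalit1987, Ch. I §3.1, §3.8 (17)] -/
theorem linearIndependent_deltaFun : LinearIndependent (PowerSeries S) (deltaFun hπ hq ι u hu γ) := by
  rw [Fintype.linearIndependent_iff]
  intro g hg j
  obtain ⟨ab, -, huniq⟩ := existsUnique_tAct_one_add_tAct_delta_base hπ hq ι hreg u hu γ w hγ (0 : PowerSeries S)
  have h1 : (g 0, g 1) = ab := huniq (g 0, g 1) (by
    have h := congrArg TActModule.toPS hg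
    rwa [toPS_sum_smul_deltaFun, map_zero] at h)
  have h2 : ((0 : PowerSeries S), (0 : PowerSeries S)) = ab := huniq (0, 0) (by
    have h := congrArg TActModule.toPS
      (show ∑ j : Fin 2, (fun _ => (0 : PowerSeries S)) j • deltaFun hπ hq ι u hu γ j = 0 from
        Finset.sum_eq_zero fun j _ => zero_smul _ _)
    rwa [toPS_sum_smul_deltaFun, map_zero] at h)
  have h12 := h1.trans h2.symm
  fin_cases j
  · exact congrArg Prod.fst h12
  · exact congrArg Prod.snd h12

include hreg hγ in
/-- ★ `1, σ_{−1}(1)` span the coordinate module over `Λ` (existence half of `existsUnique_tAct_one_add_tAct_delta_base`).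
[cite: deShalit1987, Ch. I §3.1, §3.8 (17)] -/
theorem span_deltaFun_eq_top : Submodule.span (PowerSeries S) (Set.range (deltaFun hπ hq ι u hu γ)) = ⊤ := by
  refine Submodule.eq_top_iff'.mpr fun V => ?_
  obtain ⟨ab, hab, -⟩ := existsUnique_tAct_one_add_tAct_delta_base hπ hq ι hreg u hu γ w hγ (TActModule.toPS V)
  have hV : V = ∑ j : Fin 2, (![ab.1, ab.2] : Fin 2 → PowerSeries S) j • deltaFun hπ hq ι u hu γ j := by
    apply TActModule.toPS_injective
    rw [toPS_sum_smul_deltaFun, Matrix.cons_val_zero, Matrix.cons_val_one, Matrix.cons_val_zero, hab]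
  rw [hV]
  exact Submodule.sum_mem _ fun j _ => Submodule.smul_mem _ _ (Submodule.subset_span (Set.mem_range_self j))

/-- ★★ **The `Λ`-basis `{1, σ_{−1}(1)}`: the coordinate module is `Λ·1 ⊕ Λ·σ_{−1}(1)`** — free of rank ONE over `Λ[Δ]`, `Δ = {±1}`,
generated by `1` (de Shalit's "`ℤ_p⟦𝒢⟧ = Λ[Δ]`", `𝒰 ≅ Λ(𝒢)` on the series side at `p = 2`). [cite: deShalit1987, Ch. I §3.1, §3.8 (17); Ch. III §1.3] -/
def coordBasisDelta : Module.Basis (Fin 2) (PowerSeries S) (ColemanCoordModule hπ hq ι u hu γ) :=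
  Module.Basis.mk (linearIndependent_deltaFun hπ hq ι u hu γ hreg w hγ) (span_deltaFun_eq_top hπ hq ι u hu γ hreg w hγ).ge

/-- The `Δ`-basis vectors are `1` and `σ_{−1}(1)`. [cite: deShalit1987, Ch. I §3.1] -/
@[simp] theorem coordBasisDelta_apply (j : Fin 2) : coordBasisDelta hπ hq ι u hu γ hreg w hγ j = deltaFun hπ hq ι u hu γ j := by
  rw [coordBasisDelta, Module.Basis.mk_apply]

/-- `coordBasisDelta 0 = 1`. [cite: deShalit1987, Ch. I §3.1] -/
theorem coordBasisDelta_zero : coordBasisDelta hπ hq ι u hu γ hreg w hγ 0 = TActModule.ofPS _ _ 1 := by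
  rw [coordBasisDelta_apply]; rfl

/-- `coordBasisDelta 1 = σ_{−1}(1)`. [cite: deShalit1987, Ch. I §3.1] -/
theorem coordBasisDelta_one :
    coordBasisDelta hπ hq ι u hu γ hreg w hγ 1 = unitTwistₗ hπ hq ι u hu γ (-1) (TActModule.ofPS _ _ 1) := by
  rw [coordBasisDelta_apply]; rfl

/-- ★ **Every element is UNIQUELY `a • 1 + b • σ_{−1}(1)`**, module form. [cite: deShalit1987, Ch. I §3.1, §3.8 (17)] -/
theorem eq_repr_zero_smul_one_add_repr_one_smul (r : ColemanCoordModule hπ hq ι u hu γ) :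
    r = (coordBasisDelta hπ hq ι u hu γ hreg w hγ).repr r 0 • TActModule.ofPS _ _ 1 +
      (coordBasisDelta hπ hq ι u hu γ hreg w hγ).repr r 1 • unitTwistₗ hπ hq ι u hu γ (-1) (TActModule.ofPS _ _ 1) := by
  conv_lhs => rw [← (coordBasisDelta hπ hq ι u hu γ hreg w hγ).sum_repr r]
  rw [Fin.sum_univ_two, coordBasisDelta_zero, coordBasisDelta_one]

/-! ### §4. The two-variable instance `S = 𝒪_F⟦X⟧`, `ι = C`: `𝒪_F⟦X⟧⟦Y⟧` over `Λ = 𝒪_F⟦X⟧⟦T⟧` -/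

/-- ★★ **The two-variable Coleman coordinate module `𝒪_F⟦X⟧⟦Y⟧` has rank `2` over `Λ = 𝒪_F⟦X⟧⟦T⟧`** (`T ↦ D_γ^{𝒪⟦X⟧}`, the unramified
variable `X = φ − 1` acting through the coefficients). [cite: deShalit1987, Ch. I §3.8 (17); Ch. III §1.3] -/
theorem finrank_colemanCoordModule_C (u : (LTCoeff F)ˣ) (hu : LTCoeff.of F π = residueFieldCard F * u) (γ w : 𝒪[F]ˣ)
    (hγ : (γ : 𝒪[F]) = 1 + π ^ 2 * w) :
    haveI := isAdicComplete_span_C_LTCoeff hπ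
    Module.finrank (PowerSeries (PowerSeries (LTCoeff F))) (ColemanCoordModule hπ hq (PowerSeries.C (R := LTCoeff F)) u hu γ) = 2 := by
  haveI := isAdicComplete_span_C_LTCoeff hπ
  haveI : Nontrivial (LTCoeff F) := nontrivial_of_ne (LTCoeff.of F π) 0 fun h0 => hπ.ne_zero (by
    have := congrArg (fun x => (((LTCoeff.of F).symm x : 𝒪[F]) : F)) h0
    simpa using this)
  exact finrank_colemanCoordModule hπ hq PowerSeries.C u hu γ (eq_zero_of_C_pi_mul_eq_zero hπ) w hγ

/-- **The unramified variable acts through the coefficients**: for `s ∈ S` (e.g. `s = 1 + X ∈ 𝒪_F⟦X⟧`, the Frobenius), `(C s) • G = s·G`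
coefficientwise in `Y`. [cite: deShalit1987, Ch. I §3.8 (17)] -/
theorem C_smul_colemanCoordModule (s : S) (G : ColemanCoordModule hπ hq ι u hu γ) :
    (PowerSeries.C s : PowerSeries S) • G = TActModule.ofPS _ _ (PowerSeries.C s * TActModule.toPS G) :=
  TActModule.C_smul s G

end CoordModuleTwo

end Literature.NumberTheory.GaloisRepresentations
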